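import Summits.ValiantsHypothesis.ValiantsHypothesis.Theorems.NNDivisionHard.Negative.BlindCubeIdentity

/-!
PORT NOTE (val-port-3 g3, desk val-lit g14 RULING #365 (B); critic of record val-idea-crit-9 g2 GO of record; author val-idea-39 g4's staged bytes
`pub/ideators/val-idea-39/lmr/staged/g4-WeakReliefBlind/WeakReliefBlind.lean` sha16 055c24f1cd1da07d = the crux workfile
`Cruxes/NNDivisionHard/WeakReliefBlind39.lean` rev 2 @a9c8fb5f1d4d (928aac523a62222f) modulo namespace): texts VERBATIM BY NAME; the ONLY changes are two one-line docstrings (`cOne_cases`, `cTwo_cases`; gate lint) and the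
400-line-cap SPLIT — this file = §1 (the weak-relief identity), `…/Negative/WeakReliefBlindPermutahedron.lean` = §2 (the untilted permutahedral rows),
importing this one.  ALL CREDIT: val-idea-39 g4.
# The weak-relief blindness identity: `(1 − |a∩b|)² + α_a|a∖P| + β_a|P∖a|` has nonnegative rank `≤ 2n² + 4n + 1`
# as soon as `α_a ≥ 1` and `β_a ≥ |a|` (crux `FifoMatching.NNDivisionHard`, stmt-ValiantsHypothesis-21181; crux WORKFILE — the Negative-lane port
# `Theorems/NNDivisionHard/Negative/WeakReliefBlind.lean` is staged verbatim with namespace `…Theorems.NNDivisionHardNegative.WeakReliefBlind`)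

val-idea-39 g4 (WAVE-6 seat W6-P2, lens «information-complexity / common-information bounds»), critic of record
val-idea-crit-9 g2.  THE CLIQUE-ROW CAP, SHARPENED.  The blind-cube identity of record (✓ p670959 `BlindCubeIdentity.blind_identity`)
factors `(1 − |a∩b|)² + λ|a||aΔP|` nonnegatively through `2n² + 3n + 2` slots for `λ ≥ max(1, n−1)`, i.e. it needs a RELIEF of
`λ|a| ≥ (n−1)|a|` per unit of Hamming distance `|aΔP|` to the private maximiser `P = a`; every blindness certificate on the record so far
(`Q♮`, `Q∘` ✓ p674104, `Q^c`) pays at least that.  This file proves that the true threshold is TWO ORDERS LOWER and splits by side: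

★ `weak_identity` / `weak_rankPlus_le` — for EVERY `n`, every row `a ⊆ [n]` with weights `α_a ≥ 1` (per element of `a∖P`, "missing") and
`β_a ≥ |a|` (per element of `P∖a`, "extra"), and every column `(b, P)`,
`(1 − |a∩b|)² + α_a·|a∖P| + β_a·|P∖a| = Σ_{idx ∈ WIdx n} weakRow a idx · weakCol (b,P) idx` with `weakRow ≥ 0`, `weakCol ≥ 0` and
`|WIdx n| = 2n² + 4n + 1`; the weights may vary with the row (`α β : Finset (Fin n) → ℤ`).

MECHANISM (an information-cost reading: the column only has to reveal the CLASS `p = |P∩b| ∈ {0, 1, ≥2}` and, per coordinate, O(1) bits).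
Write `X = 𝟙_a, Y = 𝟙_b, Π = 𝟙_P, t = |a∩b|, s = |a∩b∩P|, p = |P∩b|`.  Three column classes:
* `p = 0`:  `E = 1 + Σ_i X_i(1−Π_i)(1−Y_i) + Σ_{i≠m} X_iX_m·Y_iY_m + Σ_{i,m} (1−X_i)X_m·Π_i`   (`a∩b ⊆ a∖P` pays `−t`);
* `p = 1`:  `E = Σ_i (1−X_i)·Π_iY_i + Σ_i X_i(1−Π_i)(1−Y_i) + Σ_{i≠m} X_iX_m·Y_iY_m + Σ_{i,m}(1−X_i)X_m·Π_i`   (the constant `1 = p` is spent);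
* `p ≥ 2`:  `(1−t)² = 1 + s(p−2) + (t−s)(t−1) + (t−s)(p−1) − (p−s)t` and the only negative term is charged to the extra elements:
  `β_a|P∖a| − (p−s)t ≥ Σ_{i,m} (1−X_i)X_m·Π_i(1 − Y_iY_m) ≥ 0` — this is where `β_a ≥ |a|` (one unit per element of `a`, NOT `n−1`) is used;
  `α_a ≥ 1` is used only in the classes `p ≤ 1`.
Seven slot families (`WIdx`): `1·[p≠1]`, `X_i·(…)`, `X_iX_m·Y_iY_m(1−[p≥2]Π_i)` (`i≠m`), `(1−X_i)X_m·Π_i(1−[p≥2]Y_iY_m)`, `(1−X_i)·[p=1]Π_iY_i`,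
surplus `(α_a−1)X_i·(1−Π_i)`, `(β_a−|a|)(1−X_i)·Π_i`.  All factors are integers; we state them over `ℤ` and cast.

CONSEQUENCES (recorded for the W6 seats; nothing below is used in the proofs).
(1) Every passenger whose clique-row recourse dominates `|a∖P| + |a|·|P∖a|` coordinatewise is clique-blind with `O(n²)` slots: this covers
    `Q♮` at `λ = 1` (recourse `|a|·|aΔP|`; the record needed `λ ≥ n−1`), `Q∘`, `Q^c`, the bit-diagonal cube `Q^w` of my 22:14:59Z line
    (`R_k = 2+2w(k−1)−k(k−1) ≥ 1`, `B_k = k(k−1) ≥ k` for `k ≥ 2`), and val-idea-38 g2's weak-relief family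
    `WR(λ₁,λ₂) = (1−|a∩b|)² + |a|(λ₁|a∖P| + λ₂|P∖a|)` for ALL `λ₂ ≥ 1`, `λ₁ ≥ 1/|a|` — 38 g2's named obstruction (3) (22:40:27Z:
    «WR(λ₂) quasi-poly for 1 ≤ λ₂ ≤ n−2?») is settled on the BLIND side: there is no threshold between `1` and `n−1`.
(2) For the C⁺_entry (`LocatedPencilLaw`) enemy hunt (critic N18 (c), «hereditarily blind under pair-pinning»): the residual clique game
    left on a located face needs only UNIT reliefs on the missing side and `|a|` on the extra side — the design space for local /
    sparse-generator cubes (38's `Q_pair`, crit-3's `Z_mix`, degree cubes) is wider by a factor `n` than the `λ ≥ n−1` floor suggested.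
(3) LP EVIDENCE beyond the theorem (exact two-phase simplex over the symmetric degree-2 certificate space, per (row-histogram,
    column-histogram) fibre; session folder `qw/fiberlp.py`): the degree-2 fibre LP is feasible for ALL fibres, `n ≤ 8`, already at
    `(α, β) = (1, 1)` — the PURE HAMMING relief `(1−|a∩b|)² + |aΔP|` — and at `(1, |a|/2)`, `(1/2, |a|)`; it is INFEASIBLE at `α = 0`
    (first failures `n = 6`, row `|a| = 3`).  Conjecture HB (kernel target, not claimed): `rank₊[(1−|a∩b|)² + |aΔP|] ≤ O(n⁴)`.
Theorems and concrete data only; VP ≠ VNP is NOT proved; the crux `NNDivisionHard` and C⁺_entry stay OPEN.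
-/

-- the mandated summit-side namespace repeats a component by design (single-problem summit)
set_option linter.dupNamespace false

namespace Summit.ValiantsHypothesis.Theorems.NNDivisionHardNegative.WeakReliefBlind

open Finset
open Summit.ValiantsHypothesis.Theorems.NNDivisionHardNegative.BlindCubeIdentity
  (ind ind_nonneg ind_le_one ind_mul_self ind_inter sum_ind sum_ind_mul sum_ite_eq_sub)

/-- index type of the factorization: `1 + n + n² + n² + n + n + n = 2n² + 4n + 1` terms (diagonal slots of the third family carry `0`). -/
abbrev WIdx (n : ℕ) := Unit ⊕ Fin n ⊕ (Fin n × Fin n) ⊕ (Fin n × Fin n) ⊕ Fin n ⊕ Fin n ⊕ Fin n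

/-- `|WIdx n| = 2n² + 4n + 1`. -/
theorem card_WIdx (n : ℕ) : Fintype.card (WIdx n) = 2 * n ^ 2 + 4 * n + 1 := by
  simp [WIdx, Fintype.card_sum, Fintype.card_prod, Fintype.card_fin]; ring

section IntCore
variable {n : ℕ}

/-- column class indicator `[|P ∩ b| = 1]` -/
def cOne (b P : Finset (Fin n)) : ℤ := if (P ∩ b).card = 1 then 1 else 0

/-- column class indicator `[|P ∩ b| ≥ 2]` -/
def cTwo (b P : Finset (Fin n)) : ℤ := if 2 ≤ (P ∩ b).card then 1 else 0

/-- row factors `U(a, idx) ≥ 0` (weights `α = α_a`, `β = β_a` of the row) -/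
def weakRow (α β : ℤ) (a : Finset (Fin n)) : WIdx n → ℤ
  | Sum.inl _ => 1
  | Sum.inr (Sum.inl i) => ind a i
  | Sum.inr (Sum.inr (Sum.inl (i, m))) => if i = m then 0 else ind a i * ind a m
  | Sum.inr (Sum.inr (Sum.inr (Sum.inl (i, m)))) => (1 - ind a i) * ind a m
  | Sum.inr (Sum.inr (Sum.inr (Sum.inr (Sum.inl i)))) => 1 - ind a i
  | Sum.inr (Sum.inr (Sum.inr (Sum.inr (Sum.inr (Sum.inl i))))) => (α - 1) * ind a i
  | Sum.inr (Sum.inr (Sum.inr (Sum.inr (Sum.inr (Sum.inr i))))) => (β - (a.card : ℤ)) * (1 - ind a i)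

/-- column factors `V((b,P), idx) ≥ 0` (`p = |P ∩ b|`, classes `[p = 1]`, `[p ≥ 2]`) -/
def weakCol (b P : Finset (Fin n)) : WIdx n → ℤ
  | Sum.inl _ => 1 - cOne b P
  | Sum.inr (Sum.inl i) =>
      (1 - ind P i) * (1 - ind b i) * (1 - cTwo b P) +
        cTwo b P * (ind b i * ind P i * (((P ∩ b).card : ℤ) - 2) + ind b i * (1 - ind P i) * (((P ∩ b).card : ℤ) - 1) +
          (1 - ind P i))
  | Sum.inr (Sum.inr (Sum.inl (i, m))) => ind b i * ind b m * (1 - cTwo b P * ind P i)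
  | Sum.inr (Sum.inr (Sum.inr (Sum.inl (i, m)))) => ind P i * (1 - cTwo b P * (ind b i * ind b m))
  | Sum.inr (Sum.inr (Sum.inr (Sum.inr (Sum.inl i)))) => cOne b P * (ind P i * ind b i)
  | Sum.inr (Sum.inr (Sum.inr (Sum.inr (Sum.inr (Sum.inl i))))) => 1 - ind P i
  | Sum.inr (Sum.inr (Sum.inr (Sum.inr (Sum.inr (Sum.inr i))))) => ind P i

/-- the target entry `(1 − |a∩b|)² + α|a∖P| + β|P∖a|` over `ℤ` (`|a∖P| = |a| − |a∩P|`, `|P∖a| = |P| − |a∩P|`) -/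
def weakLHS (α β : ℤ) (a b P : Finset (Fin n)) : ℤ :=
  (1 - ((a ∩ b).card : ℤ)) ^ 2 + α * ((a.card : ℤ) - ((a ∩ P).card : ℤ)) + β * ((P.card : ℤ) - ((a ∩ P).card : ℤ))

/-- `cOne` is `0` or `1`. (docstring added in the port) -/
theorem cOne_cases (b P : Finset (Fin n)) : cOne b P = 0 ∨ cOne b P = 1 := by
  unfold cOne; split_ifs <;> simp

/-- `cTwo` is `0` or `1`. (docstring added in the port) -/
theorem cTwo_cases (b P : Finset (Fin n)) : cTwo b P = 0 ∨ cTwo b P = 1 := by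
  unfold cTwo; split_ifs <;> simp

/-- row factors are nonnegative as soon as `α ≥ 1` and `β ≥ |a|`. -/
theorem weakRow_nonneg {α β : ℤ} {a : Finset (Fin n)} (hα : 1 ≤ α) (hβ : (a.card : ℤ) ≤ β) (idx : WIdx n) :
    0 ≤ weakRow α β a idx := by
  have h0 := ind_nonneg a; have h1 := ind_le_one a
  rcases idx with _ | i | ⟨i, m⟩ | ⟨i, m⟩ | i | i | i <;> simp only [weakRow]
  · norm_num
  · exact h0 i
  · split_ifs
    · exact le_rfl
    · exact mul_nonneg (h0 i) (h0 m)
  · exact mul_nonneg (by linarith [h1 i]) (h0 m)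
  · linarith [h1 i]
  · exact mul_nonneg (by linarith) (h0 i)
  · exact mul_nonneg (by linarith) (by linarith [h1 i])

/-- column factors are nonnegative (no hypothesis). -/
theorem weakCol_nonneg (b P : Finset (Fin n)) (idx : WIdx n) : 0 ≤ weakCol b P idx := by
  have h0 := ind_nonneg (n := n); have h1 := ind_le_one (n := n)
  have hpc : (0 : ℤ) ≤ ((P ∩ b).card : ℤ) := Nat.cast_nonneg _
  rcases idx with _ | i | ⟨i, m⟩ | ⟨i, m⟩ | i | i | i <;> simp only [weakCol]
  · rcases cOne_cases b P with h | h <;> rw [h] <;> norm_num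
  · unfold cTwo
    split_ifs with h2
    · have h2' : (2 : ℤ) ≤ ((P ∩ b).card : ℤ) := by exact_mod_cast h2
      have t1 : 0 ≤ ind b i * ind P i * (((P ∩ b).card : ℤ) - 2) :=
        mul_nonneg (mul_nonneg (h0 b i) (h0 P i)) (by linarith)
      have t2 : 0 ≤ ind b i * (1 - ind P i) * (((P ∩ b).card : ℤ) - 1) :=
        mul_nonneg (mul_nonneg (h0 b i) (by linarith [h1 P i])) (by linarith)
      nlinarith [h1 P i, mul_nonneg (by linarith [h1 P i] : (0:ℤ) ≤ 1 - ind P i) (by linarith [h1 b i] : (0:ℤ) ≤ 1 - ind b i)]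
    · nlinarith [h1 P i, mul_nonneg (by linarith [h1 P i] : (0:ℤ) ≤ 1 - ind P i) (by linarith [h1 b i] : (0:ℤ) ≤ 1 - ind b i)]
  · refine mul_nonneg (mul_nonneg (h0 b i) (h0 b m)) ?_
    rcases cTwo_cases b P with h | h <;> rw [h] <;> nlinarith [h1 P i, h0 P i]
  · refine mul_nonneg (h0 P i) ?_
    rcases cTwo_cases b P with h | h <;> rw [h] <;> nlinarith [h1 b i, h0 b i, h1 b m, h0 b m, mul_nonneg (h0 b i) (h0 b m),
      mul_le_one₀ (h1 b i) (h0 b m) (h1 b m)]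
  · rcases cOne_cases b P with h | h <;> rw [h] <;> nlinarith [h0 P i, h0 b i, mul_nonneg (h0 P i) (h0 b i)]
  · linarith [h1 P i]
  · exact h0 P i

/-- helper: `X_i Y_i Π_i = 𝟙_{a∩b∩P}`. -/
theorem ind_inter3 (a b P : Finset (Fin n)) (i : Fin n) : ind a i * ind b i * ind P i = ind (a ∩ b ∩ P) i := by
  rw [ind_inter, ind_inter]

/-- helper: `Σ_i X_i Y_i Π_i = |a ∩ b ∩ P|`. -/
theorem sum_ind_mul3 (a b P : Finset (Fin n)) : ∑ i, ind a i * ind b i * ind P i = ((a ∩ b ∩ P).card : ℤ) := by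
  simp_rw [ind_inter3]; exact sum_ind _

/-- the seven blocks of a sum over `WIdx n` -/
theorem sum_WIdx (f : WIdx n → ℤ) :
    ∑ idx, f idx = f (Sum.inl ()) +
      ((∑ i, f (Sum.inr (Sum.inl i))) +
      ((∑ i, ∑ m, f (Sum.inr (Sum.inr (Sum.inl (i, m))))) +
      ((∑ i, ∑ m, f (Sum.inr (Sum.inr (Sum.inr (Sum.inl (i, m)))))) +
      ((∑ i, f (Sum.inr (Sum.inr (Sum.inr (Sum.inr (Sum.inl i)))))) +
      ((∑ i, f (Sum.inr (Sum.inr (Sum.inr (Sum.inr (Sum.inr (Sum.inl i))))))) +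
       (∑ i, f (Sum.inr (Sum.inr (Sum.inr (Sum.inr (Sum.inr (Sum.inr i)))))))))))) := by
  simp only [Fintype.sum_sum_type, Fintype.sum_prod_type, Fintype.sum_unique]

/-- ★★ **THE WEAK-RELIEF IDENTITY, ALL `n`, ALL `α β`** (sorry-free, axioms standard):
`(1 − |a∩b|)² + α|a∖P| + β|P∖a| = Σ_idx weakRow α β a idx · weakCol b P idx`.
Proof = per-coordinate regrouping (`X_i² = X_i`, `Σ_m X_m = |a|`, `Σ_m X_mY_m = |a∩b|`) down to the defect
`[p=1](p−1) + [p=0]·|a∩b∩P|`, which vanishes in each column class. -/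
theorem weak_identity (α β : ℤ) (a b P : Finset (Fin n)) :
    weakLHS α β a b P = ∑ idx : WIdx n, weakRow α β a idx * weakCol b P idx := by
  classical
  rw [sum_WIdx]
  simp only [weakRow, weakCol]
  have hX2 := ind_mul_self a
  have hY2 := ind_mul_self b
  have hP2 := ind_mul_self P
  have sX := sum_ind a
  have sP := sum_ind P
  have sXY := sum_ind_mul a b
  have sPY := sum_ind_mul P b
  have sXP := sum_ind_mul a P
  have sXYP := sum_ind_mul3 a b P
  set c₁ : ℤ := cOne b P with hc₁
  set c₂ : ℤ := cTwo b P with hc₂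
  set p : ℤ := ((P ∩ b).card : ℤ) with hp
  -- family `X_i X_m (m ≠ i)`: closed form per `i`
  have F2 : ∀ i, ∑ m, (if i = m then 0 else ind a i * ind a m) * (ind b i * ind b m * (1 - c₂ * ind P i)) =
      ind a i * ind b i * (1 - c₂ * ind P i) * (((a ∩ b).card : ℤ) - 1) := by
    intro i
    have : ∀ m, (if i = m then 0 else ind a i * ind a m) * (ind b i * ind b m * (1 - c₂ * ind P i)) =
        if i = m then 0 else ind a i * ind a m * (ind b i * ind b m * (1 - c₂ * ind P i)) := by
      intro m; split_ifs <;> ring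
    simp_rw [this]
    rw [sum_ite_eq_sub, hX2, hY2]
    have hs : ∑ m, ind a i * ind a m * (ind b i * ind b m * (1 - c₂ * ind P i)) =
        ind a i * ind b i * (1 - c₂ * ind P i) * ∑ m, ind a m * ind b m := by
      rw [Finset.mul_sum]
      exact Finset.sum_congr rfl fun m _ => by ring
    rw [hs, sXY]; ring
  -- family `(1 − X_i) X_m` (all `m`): closed form per `i`
  have F3 : ∀ i, ∑ m, (1 - ind a i) * ind a m * (ind P i * (1 - c₂ * (ind b i * ind b m))) =
      (1 - ind a i) * ind P i * ((a.card : ℤ) - c₂ * ind b i * ((a ∩ b).card : ℤ)) := by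
    intro i
    have hs : ∑ m, (1 - ind a i) * ind a m * (ind P i * (1 - c₂ * (ind b i * ind b m))) =
        (1 - ind a i) * ind P i * (∑ m, ind a m - c₂ * ind b i * ∑ m, ind a m * ind b m) := by
      rw [Finset.mul_sum, ← Finset.sum_sub_distrib, Finset.mul_sum]
      exact Finset.sum_congr rfl fun m _ => by ring
    rw [hs, sX, sXY]
  simp_rw [F2, F3]
  -- per-coordinate polynomial
  have per : ∀ i,
      ind a i * ((1 - ind P i) * (1 - ind b i) * (1 - c₂) +
          c₂ * (ind b i * ind P i * (p - 2) + ind b i * (1 - ind P i) * (p - 1) + (1 - ind P i))) +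
      (ind a i * ind b i * (1 - c₂ * ind P i) * (((a ∩ b).card : ℤ) - 1) +
      ((1 - ind a i) * ind P i * ((a.card : ℤ) - c₂ * ind b i * ((a ∩ b).card : ℤ)) +
      ((1 - ind a i) * (c₁ * (ind P i * ind b i)) +
      ((α - 1) * ind a i * (1 - ind P i) +
       (β - (a.card : ℤ)) * (1 - ind a i) * ind P i)))) =
      α * ind a i + β * ind P i - (α + β) * (ind a i * ind P i)
        + (c₂ * p + ((a ∩ b).card : ℤ) - 2) * (ind a i * ind b i)
        + (c₁ - c₂ * ((a ∩ b).card : ℤ)) * (ind P i * ind b i)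
        + (1 - c₁ - c₂) * (ind a i * ind b i * ind P i) := by
    intro i
    ring
  rw [← Finset.sum_add_distrib, ← Finset.sum_add_distrib, ← Finset.sum_add_distrib, ← Finset.sum_add_distrib,
    ← Finset.sum_add_distrib]
  rw [Finset.sum_congr rfl (fun i _ => per i)]
  rw [Finset.sum_add_distrib, Finset.sum_add_distrib, Finset.sum_add_distrib, Finset.sum_sub_distrib,
    Finset.sum_add_distrib, ← Finset.mul_sum, ← Finset.mul_sum, ← Finset.mul_sum, ← Finset.mul_sum, ← Finset.mul_sum,
    ← Finset.mul_sum, sX, sP, sXP, sXY, sPY, sXYP, weakLHS]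
  -- the defect `c₁(p−1) + (1−c₁−c₂)s` vanishes in each column class
  have hsub : a ∩ b ∩ P ⊆ P ∩ b := by
    intro x hx
    simp only [Finset.mem_inter] at hx ⊢
    exact ⟨hx.2, hx.1.2⟩
  have hs_le : ((a ∩ b ∩ P).card : ℤ) ≤ p := by rw [hp]; exact_mod_cast Finset.card_le_card hsub
  have hs0 : (0 : ℤ) ≤ ((a ∩ b ∩ P).card : ℤ) := Nat.cast_nonneg _
  obtain h0 | h1 | h2 : (P ∩ b).card = 0 ∨ (P ∩ b).card = 1 ∨ 2 ≤ (P ∩ b).card := by omega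
  · have e1 : c₁ = 0 := by rw [hc₁, cOne, h0]; simp
    have e2 : c₂ = 0 := by rw [hc₂, cTwo, h0]; simp
    have e3 : p = 0 := by rw [hp, h0]; simp
    have e4 : ((a ∩ b ∩ P).card : ℤ) = 0 := by linarith
    rw [e1, e2, e4, e3]; ring
  · have e1 : c₁ = 1 := by rw [hc₁, cOne, h1]; simp
    have e2 : c₂ = 0 := by rw [hc₂, cTwo, h1]; simp
    have e3 : p = 1 := by rw [hp, h1]; simp
    rw [e1, e2, e3]; ring
  · have e1 : c₁ = 0 := by rw [hc₁, cOne]; simp; omega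
    have e2 : c₂ = 1 := by rw [hc₂, cTwo]; simp [h2]
    rw [e1, e2]; ring
end IntCore

/-- ★★ **`rank₊ ≤ 2n² + 4n + 1` for the weak relief**: for every `n` and all row weights `α β : Finset (Fin n) → ℤ` with `1 ≤ α a` and
`|a| ≤ β a` there are NONNEGATIVE real `U : Finset (Fin n) → WIdx n → ℝ`, `V : Finset (Fin n) × Finset (Fin n) → WIdx n → ℝ` with
`(1 − |a∩b|)² + α_a(|a| − |a∩P|) + β_a(|P| − |a∩P|) = Σ_idx U a idx · V (b,P) idx` for all `a b P`. -/
theorem weak_rankPlus_le (n : ℕ) (α β : Finset (Fin n) → ℤ) (hα : ∀ a, 1 ≤ α a) (hβ : ∀ a, (a.card : ℤ) ≤ β a) :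
    ∃ (U : Finset (Fin n) → WIdx n → ℝ) (V : Finset (Fin n) × Finset (Fin n) → WIdx n → ℝ),
      (∀ a idx, 0 ≤ U a idx) ∧ (∀ bP idx, 0 ≤ V bP idx) ∧
      ∀ a b P : Finset (Fin n),
        ((1 : ℝ) - ((a ∩ b).card : ℝ)) ^ 2
            + (α a : ℝ) * ((a.card : ℝ) - ((a ∩ P).card : ℝ)) + (β a : ℝ) * ((P.card : ℝ) - ((a ∩ P).card : ℝ))
          = ∑ idx, U a idx * V (b, P) idx := by
  refine ⟨fun a idx => (weakRow (α a) (β a) a idx : ℝ), fun bP idx => (weakCol bP.1 bP.2 idx : ℝ),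
    fun a idx => Int.cast_nonneg_iff.mpr (weakRow_nonneg (hα a) (hβ a) idx) |>.trans_eq (by simp),
    fun bP idx => Int.cast_nonneg_iff.mpr (weakCol_nonneg bP.1 bP.2 idx) |>.trans_eq (by simp), ?_⟩
  intro a b P
  have h := congrArg (fun z : ℤ => (z : ℝ)) (weak_identity (α a) (β a) a b P)
  simp only [weakLHS, Int.cast_add, Int.cast_pow, Int.cast_sub, Int.cast_one, Int.cast_mul, Int.cast_natCast,
    Int.cast_sum] at h
  simpa using h

/-- ★ **THE RECORD'S IDENTITY AT `λ = 1`**: `(1 − |a∩b|)² + λ|a|·|aΔP|` is an explicit nonnegative factorization of size `2n² + 4n + 1`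
for EVERY integer `λ ≥ 1` (✓ p670959 needed `λ ≥ n − 1`) — the instance `α_a = β_a = λ|a|` for `a ≠ ∅` (`α_∅ = β_∅ = 1`). -/
theorem blindCube_rankPlus_le_of_one_le (n : ℕ) (lam : ℤ) (hlam : 1 ≤ lam) :
    ∃ (U : Finset (Fin n) → WIdx n → ℝ) (V : Finset (Fin n) × Finset (Fin n) → WIdx n → ℝ),
      (∀ a idx, 0 ≤ U a idx) ∧ (∀ bP idx, 0 ≤ V bP idx) ∧
      ∀ a b P : Finset (Fin n),
        ((1 : ℝ) - ((a ∩ b).card : ℝ)) ^ 2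
            + (lam : ℝ) * ((a.card : ℝ) * ((a.card : ℝ) + (P.card : ℝ) - 2 * ((a ∩ P).card : ℝ)))
          = ∑ idx, U a idx * V (b, P) idx := by
  classical
  -- weights: `β_a = λ|a|` (so `β_∅ = 0`), `α_a = λ|a|` for `a ≠ ∅` and `α_∅ = 1` (it multiplies `|∅∖P| = 0`)
  let wα : Finset (Fin n) → ℤ := fun a => if a = ∅ then 1 else lam * (a.card : ℤ)
  let wβ : Finset (Fin n) → ℤ := fun a => lam * (a.card : ℤ)
  have hw1 : ∀ a, 1 ≤ wα a := by
    intro a; simp only [wα]; split_ifs with h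
    · exact le_rfl
    · have : 1 ≤ a.card := Finset.card_pos.2 (Finset.nonempty_iff_ne_empty.2 h)
      have : (1 : ℤ) ≤ (a.card : ℤ) := by exact_mod_cast this
      nlinarith
  have hw2 : ∀ a, (a.card : ℤ) ≤ wβ a := by
    intro a; simp only [wβ]
    have : (0 : ℤ) ≤ (a.card : ℤ) := Nat.cast_nonneg _
    nlinarith
  obtain ⟨U, V, hU, hV, hfac⟩ := weak_rankPlus_le n wα wβ hw1 hw2
  refine ⟨U, V, hU, hV, fun a b P => ?_⟩
  rw [← hfac a b P]
  by_cases h : a = ∅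
  · subst h; simp [wα, wβ]
  · simp only [wα, wβ, h, if_false, Int.cast_mul, Int.cast_natCast]; ring

end Summit.ValiantsHypothesis.Theorems.NNDivisionHardNegative.WeakReliefBlind
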